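import Summits.HodgeConjecture.HodgeConjecture.Theorems.F0P2oTwistCoinvariantsCommute   -- ★ p831392 (this seat): HEADS (1)(2) `comap_mk_coinvariantsKer`, `comap_mk_twistedKer`
import HarnessLib

/-!
# Crux `H413`, programme P2, N3 road (S4) — NON-VANISHING TRANSFERS ACROSS THE TWIST ∕ COINVARIANTS SWAP

Cell hodgecm-mathlib (D-0151), FLOOR 0, crux item H413 = stmt-HodgeConjecture-24833, programme P2; N3 road §2 (S4), sequel of ★ p831392
`F0P2oTwistCoinvariantsCommute` (F0P2-plan (g8) 18:49:32Z remark «the NON-VANISHING transfer … is how N3 (a)'s `Nonempty (… ≃ₗ ℱ_v[ψθ])` gets read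
for (non-)vanishing downstream»; seat F0P3a-p08 (g10)).  Both sides of the swap are the quotient of `S` by the SAME submodule
`Coinvariants.ker ρN ⊔ TwistedCoinv.ker ρW χ` (★ HEADS (1)(2)), so each is `Nontrivial` iff that submodule is proper, and they are non-trivial together —
stated WITHOUT choosing the equivalence.  THEOREMS ONLY (no `def`, no instance, no notation, no named fact, no `sorry`); Lines-free; kernel lane
`--supports stmt-HodgeConjecture-24833 --as helper`.  HC_CM is proved only modulo the 2 remaining named inputs (hLiu418, h413) until rung 0 closes; nothing
printed is asserted here.  Binders as in ★ `F0P2oTwistCoinvariantsCommute` (laws `hτ`, `hW♭`).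
[BernsteinZelevinsky1976, §2.30–2.33; MoeglinVignerasWaldspurger1987, Chap. 3 §IV.]

## References
* [BernsteinZelevinsky1976] I. N. Bernstein, A. V. Zelevinsky, Russian Math. Surveys 31 (1976): §2.30–2.33.
* [MoeglinVignerasWaldspurger1987] C. Mœglin, M.-F. Vignéras, J.-L. Waldspurger, LNM 1291 (1987): Chap. 3 §IV.
-/

set_option autoImplicit false
set_option linter.dupNamespace false -- the mandated namespace repeats the single-problem summit's segment

noncomputable section

open HodgeCM Representation
open Summit.HodgeConjecture.HodgeConjecture.Cruxes.H413.F0P2oTwistCoinvariantsCommute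

namespace Summit.HodgeConjecture.HodgeConjecture.Cruxes.H413.F0P2oTwistCoinvariantsCommuteNontrivial

variable {k : Type*} [CommRing k] {H N S : Type*} [Group H] [Group N] [AddCommGroup S] [Module k S]
  (ρN : Representation k N S) (ρW : Representation k H S) (χ : H →* kˣ)
  (τ : Representation k N (TwistedCoinv.Coinv ρW χ))
  (hτ : ∀ (n : N) (v : S), τ n (TwistedCoinv.mk ρW χ v) = TwistedCoinv.mk ρW χ (ρN n v))
  (ρW' : Representation k H ρN.Coinvariants)
  (hW' : ∀ (h : H) (v : S), ρW' h (Coinvariants.mk ρN v) = Coinvariants.mk ρN (ρW h v))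

include hτ in
/-- **NON-VANISHING on the `τ` side**: `τ.Coinvariants` is non-trivial iff the joint relation submodule `Coinvariants.ker ρN ⊔ TwistedCoinv.ker ρW χ` is
proper (★ HEAD (1) + Mathlib `Submodule.Quotient.nontrivial_iff`). [cite: BernsteinZelevinsky1976, §2.30–2.33] -/
theorem nontrivial_coinvariants_iff :
    Nontrivial τ.Coinvariants ↔ Coinvariants.ker ρN ⊔ TwistedCoinv.ker ρW χ ≠ ⊤ := by
  rw [← comap_mk_coinvariantsKer ρN ρW χ τ hτ]
  refine (Submodule.Quotient.nontrivial_iff (p := Coinvariants.ker τ)).trans (not_congr ⟨fun h => ?_, fun h => ?_⟩)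
  · rw [h, Submodule.comap_top]
  · exact Submodule.comap_injective_of_surjective (TwistedCoinv.mk_surjective ρW χ) (h.trans (Submodule.comap_top _).symm)

include hW' in
/-- **NON-VANISHING on the swapped side**: `TwistedCoinv.Coinv ρW♭ χ` is non-trivial iff the SAME joint relation submodule is proper (★ HEAD (2)).
[cite: MoeglinVignerasWaldspurger1987, Chap. 3 §IV] -/
theorem nontrivial_twistedCoinv_iff :
    Nontrivial (TwistedCoinv.Coinv ρW' χ) ↔ Coinvariants.ker ρN ⊔ TwistedCoinv.ker ρW χ ≠ ⊤ := by
  rw [← comap_mk_twistedKer ρN ρW χ ρW' hW']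
  refine (Submodule.Quotient.nontrivial_iff (p := TwistedCoinv.ker ρW' χ)).trans (not_congr ⟨fun h => ?_, fun h => ?_⟩)
  · rw [h, Submodule.comap_top]
  · exact Submodule.comap_injective_of_surjective (Coinvariants.mk_surjective ρN) (h.trans (Submodule.comap_top _).symm)

include hτ hW' in
/-- **the two sides of the swap are non-trivial together** (without choosing the equivalence of ★ `exists_linearEquiv_swap`).
[cite: BernsteinZelevinsky1976, §2.30–2.33] -/
theorem nontrivial_coinvariants_iff_nontrivial_twistedCoinv :
    Nontrivial τ.Coinvariants ↔ Nontrivial (TwistedCoinv.Coinv ρW' χ) :=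
  (nontrivial_coinvariants_iff ρN ρW χ τ hτ).trans (nontrivial_twistedCoinv_iff ρN ρW χ ρW' hW').symm

include hτ in
/-- the `Subsingleton` form on the `τ` side: `τ.Coinvariants` VANISHES iff the joint relation submodule is all of `S`. [cite: BernsteinZelevinsky1976, §2.30–2.33] -/
theorem subsingleton_coinvariants_iff :
    Subsingleton τ.Coinvariants ↔ Coinvariants.ker ρN ⊔ TwistedCoinv.ker ρW χ = ⊤ := by
  rw [← not_nontrivial_iff_subsingleton, nontrivial_coinvariants_iff ρN ρW χ τ hτ, not_not]

include hW' in
/-- the `Subsingleton` form on the swapped side. [cite: MoeglinVignerasWaldspurger1987, Chap. 3 §IV] -/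
theorem subsingleton_twistedCoinv_iff :
    Subsingleton (TwistedCoinv.Coinv ρW' χ) ↔ Coinvariants.ker ρN ⊔ TwistedCoinv.ker ρW χ = ⊤ := by
  rw [← not_nontrivial_iff_subsingleton, nontrivial_twistedCoinv_iff ρN ρW χ ρW' hW', not_not]

end Summit.HodgeConjecture.HodgeConjecture.Cruxes.H413.F0P2oTwistCoinvariantsCommuteNontrivial

end
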